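import Summits.CriticalPhenomena.PercolationContinuityZ3.Theorems.PercNearOneGluingNoHeavyLowerTailRestrictedAttachmentExchange
import Summits.CriticalPhenomena.PercolationContinuityZ3.Theorems.PercNearOneGluingAdditiveGluingOneBond
import HarnessLib

/-!
# `NoHeavyLowerTail` (stmt-CriticalPhenomena-4575) — the CORNER REDUCTION of the restricted-attachment exchange:
# REX for an arbitrary observer follows from the exchange of GLUED observers ("GREX"), because the
# beating deficits and the exchange functional are multi-affine in the observer's own pairs

Support file (lemma factory #8 `prim-lf-8`, gen 11; `--supports stmt-CriticalPhenomena-4575`).  No definitions, no named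
facts, no sorries.  `μ_w = prodBernoulli w` on `Fin n`, relays `A`, level `j`, `π(v) = {a ∈ A : v ↔ a}`, `L_v = {|π(v)| ≤ j}`,
`H_v = {|π(v)| > j}`, `U = {o ↔ Q} = ⋃_{x∈Q} {o ↔ x}`, exchange functional `F(w) = μ_w(U ∩ L_o ∩ H_q) − μ_w(U ∩ H_o ∩ L_q)`,
deficits `B_x(w) = μ_w(L_x) − μ_w(L_q)` (`q` beats `x` iff `B_x ≤ 0`).

* `cornerLemma` — a functional `Φ` of the pair weights that is affine in every pair of a finite set `P`
  (`Φ(w) = (1 − w e) Φ(w[e↦0]) + (w e) Φ(w[e↦1])`, `e ∈ P`) and is `≤ 0` at every CORNER of `P` over `w` (weights agreeing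
  with `w` off `P` and `{0,1}`-valued on `P`) is `≤ 0` at `w`.  Every signed combination of event probabilities is such a `Φ`
  (`stub_oneBondDecomp_k15`, the one-bond decomposition).
* `rex_of_corners_dominated` — with `P` = the pairs at the observer `o`: if at every corner `w'` (the
  observer GLUED to a set `W` of neighbours, its other pairs closed) `F(w') ≤ 0`, then `F(w) ≤ 0`; if at every corner
  `F(w') ≤ B_x(w')` for one fixed `x ∈ Q`, then `F(w) ≤ B_x(w)` (`≤ 0` when `q` beats `x`).  The point: all corners share
  the SAME observer-free graph `w⁰ = w[pairs at o ↦ 0]`.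
* `noHeavyLowerTail_of_grex` — hence the crux follows from **GREX** (glued restricted-attachment exchange, prim-lf-8
  CANDIDATES v10 B10-2; 0 violations in ≈ 48 000 exact cases, `|Q| ≤ 3`, blocks of ≤ 3 vertices incl. relays): for weights whose
  pairs at `o` are all `0` or `1` (a deterministically glued observer), with `β_x = B_x(w⁰)` the deficits BEFORE gluing:
  (GREX-0) if `β_x ≤ 0` for all `x ∈ Q` then `F(w) ≤ 0`;  (GREX-1) if `x⋆ ∈ Q` maximises `β` and `β_{x⋆} > 0` then `F(w) ≤ B_{x⋆}(w)`.
  Given GREX, for a general observer one takes `λ = 0` or `λ = e_{x⋆}` according to the sign pattern of `β(w⁰)`; every corner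
  has the same `w⁰`, so GREX bounds every corner by the same affine functional, `cornerLemma` transfers the bound to `w`, and
  beating in `w` finishes (`rex_of_grex`); then `RestrictedAttachmentExchange.noHeavyLowerTail_of_rex`.
GREX for `|Q| = 1` is a theorem (BHK two-set exchange in the frame `(W ∪ {x}, {q})` plus glue-lead persistence; companion file);
for `|Q| ≥ 2` it is the root conjecture of the exchange layer (it contains REX(2) for general observers).
-/

noncomputable section

namespace Summit.CriticalPhenomena.PercolationContinuityZ3.Theorems

open MeasureTheory Set Literature.Probability.LatticeModels Literature.Probability.Percolation
open scoped Classical BigOperators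

variable {n : ℕ}

namespace CornerReduction

/-! ### The corner lemma (multi-affinity) -/

/-- **Corner lemma.**  If `Φ` is affine in the weight of every pair of `P` and `Φ ≤ 0` at every corner of `P` over `w`
(every `w'` agreeing with `w` off `P` with `w' e ∈ {0,1}` for `e ∈ P`), then `Φ w ≤ 0`. [this work] -/
theorem cornerLemma (P : Finset (Sym2 (Fin n))) (Φ : (Sym2 (Fin n) → unitInterval) → ℝ)
    (hΦ : ∀ (w : Sym2 (Fin n) → unitInterval) (e : Sym2 (Fin n)), e ∈ P →
      Φ w = (1 - (w e : ℝ)) * Φ (Function.update w e 0) + (w e : ℝ) * Φ (Function.update w e 1))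
    (w : Sym2 (Fin n) → unitInterval)
    (hcorner : ∀ w' : Sym2 (Fin n) → unitInterval, (∀ e, e ∉ P → w' e = w e) → (∀ e ∈ P, w' e = 0 ∨ w' e = 1) → Φ w' ≤ 0) :
    Φ w ≤ 0 := by
  induction P using Finset.induction_on generalizing w with
  | empty =>
    exact hcorner w (fun _ _ => rfl) (fun e he => absurd he (Finset.notMem_empty e))
  | insert e P' heP' ih =>
    have hΦe := hΦ w e (Finset.mem_insert_self e P')
    have key : ∀ c : unitInterval, (c = 0 ∨ c = 1) → Φ (Function.update w e c) ≤ 0 := by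
      intro c hc
      refine ih (fun w'' f hf => hΦ w'' f (Finset.mem_insert_of_mem hf)) (Function.update w e c) ?_
      intro w' h1 h2
      refine hcorner w' ?_ ?_
      · intro f hf
        rw [Finset.mem_insert, not_or] at hf
        rw [h1 f hf.2, Function.update_of_ne hf.1]
      · intro f hf
        rcases Finset.mem_insert.1 hf with rfl | hf'
        · rw [h1 f heP', Function.update_self]; exact hc
        · exact h2 f hf'
    have h0 := key 0 (Or.inl rfl)
    have h1 := key 1 (Or.inr rfl)
    have ht0 : 0 ≤ (w e : ℝ) := unitInterval.nonneg (w e)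
    have ht1 : (w e : ℝ) ≤ 1 := unitInterval.le_one (w e)
    rw [hΦe]
    nlinarith

/-- One-bond affinity of a signed pair of event probabilities minus a multiple of another signed pair (the shape
`F − c · B_x` used below). [folklore] -/
theorem affine_combo (S₁ S₂ S₃ S₄ : Set (BondConfig (Fin n))) (c : ℝ) (w : Sym2 (Fin n) → unitInterval) (e : Sym2 (Fin n)) :
    ((prodBernoulli w).real S₁ - (prodBernoulli w).real S₂ - c * ((prodBernoulli w).real S₃ - (prodBernoulli w).real S₄)) =
      (1 - (w e : ℝ)) * ((prodBernoulli (Function.update w e 0)).real S₁ - (prodBernoulli (Function.update w e 0)).real S₂ -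
          c * ((prodBernoulli (Function.update w e 0)).real S₃ - (prodBernoulli (Function.update w e 0)).real S₄)) +
      (w e : ℝ) * ((prodBernoulli (Function.update w e 1)).real S₁ - (prodBernoulli (Function.update w e 1)).real S₂ -
          c * ((prodBernoulli (Function.update w e 1)).real S₃ - (prodBernoulli (Function.update w e 1)).real S₄)) := by
  rw [stub_oneBondDecomp_k15 n w e S₁, stub_oneBondDecomp_k15 n w e S₂, stub_oneBondDecomp_k15 n w e S₃,
    stub_oneBondDecomp_k15 n w e S₄]
  ring

/-! ### REX from its corners -/

/-- **REX from dominated corners.**  Let `P` be the set of pairs at the observer `o`.  If for one fixed relay `x` and one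
constant `c ≥ 0` every corner `w'` of `P` over `w` (the observer glued to some neighbours, its other pairs closed) satisfies
`F(w') ≤ c · B_x(w')`, then `F(w) ≤ c · B_x(w)`; in particular `F(w) ≤ 0` as soon as `q` beats `x` in `w`. [this work] -/
theorem rex_of_corners_dominated (w : Sym2 (Fin n) → unitInterval) (A Q : Finset (Fin n)) (o q x : Fin n) (j : ℕ)
    (c : ℝ) (hc : 0 ≤ c)
    (hcorner : ∀ w' : Sym2 (Fin n) → unitInterval, (∀ e : Sym2 (Fin n), o ∉ e → w' e = w e) →
      (∀ e : Sym2 (Fin n), o ∈ e → w' e = 0 ∨ w' e = 1) →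
      (prodBernoulli w').real ((⋃ y ∈ Q, (openConn o y : Set (BondConfig (Fin n)))) ∩
            {ω | (A.filter fun a => ω ∈ openConn o a).card ≤ j} ∩ {ω | j < (A.filter fun a => ω ∈ openConn q a).card}) -
        (prodBernoulli w').real ((⋃ y ∈ Q, (openConn o y : Set (BondConfig (Fin n)))) ∩
            {ω | j < (A.filter fun a => ω ∈ openConn o a).card} ∩ {ω | (A.filter fun a => ω ∈ openConn q a).card ≤ j}) ≤
      c * ((prodBernoulli w').real {ω : BondConfig (Fin n) | (A.filter fun a => ω ∈ openConn x a).card ≤ j} -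
        (prodBernoulli w').real {ω : BondConfig (Fin n) | (A.filter fun a => ω ∈ openConn q a).card ≤ j}))
    (hbeat : (prodBernoulli w).real {ω : BondConfig (Fin n) | (A.filter fun a => ω ∈ openConn x a).card ≤ j} ≤
      (prodBernoulli w).real {ω : BondConfig (Fin n) | (A.filter fun a => ω ∈ openConn q a).card ≤ j}) :
    (prodBernoulli w).real ((⋃ y ∈ Q, (openConn o y : Set (BondConfig (Fin n)))) ∩
          {ω | (A.filter fun a => ω ∈ openConn o a).card ≤ j} ∩ {ω | j < (A.filter fun a => ω ∈ openConn q a).card}) ≤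
      (prodBernoulli w).real ((⋃ y ∈ Q, (openConn o y : Set (BondConfig (Fin n)))) ∩
          {ω | j < (A.filter fun a => ω ∈ openConn o a).card} ∩ {ω | (A.filter fun a => ω ∈ openConn q a).card ≤ j}) := by
  set S₁ : Set (BondConfig (Fin n)) := (⋃ y ∈ Q, (openConn o y : Set (BondConfig (Fin n)))) ∩
    {ω | (A.filter fun a => ω ∈ openConn o a).card ≤ j} ∩ {ω | j < (A.filter fun a => ω ∈ openConn q a).card} with hS₁
  set S₂ : Set (BondConfig (Fin n)) := (⋃ y ∈ Q, (openConn o y : Set (BondConfig (Fin n)))) ∩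
    {ω | j < (A.filter fun a => ω ∈ openConn o a).card} ∩ {ω | (A.filter fun a => ω ∈ openConn q a).card ≤ j} with hS₂
  set S₃ : Set (BondConfig (Fin n)) := {ω | (A.filter fun a => ω ∈ openConn x a).card ≤ j} with hS₃
  set S₄ : Set (BondConfig (Fin n)) := {ω | (A.filter fun a => ω ∈ openConn q a).card ≤ j} with hS₄
  set P : Finset (Sym2 (Fin n)) := Finset.univ.filter fun e => o ∈ e with hP
  let Φ : (Sym2 (Fin n) → unitInterval) → ℝ := fun u =>
    (prodBernoulli u).real S₁ - (prodBernoulli u).real S₂ - c * ((prodBernoulli u).real S₃ - (prodBernoulli u).real S₄)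
  have hmemP : ∀ e : Sym2 (Fin n), e ∈ P ↔ o ∈ e := by
    intro e; simp only [hP, Finset.mem_filter, Finset.mem_univ, true_and]
  have key : Φ w ≤ 0 := by
    refine cornerLemma P Φ (fun u e _ => affine_combo S₁ S₂ S₃ S₄ c u e) w ?_
    intro w' h1 h2
    have h1' : ∀ e : Sym2 (Fin n), o ∉ e → w' e = w e := fun e he => h1 e (by rwa [hmemP])
    have h2' : ∀ e : Sym2 (Fin n), o ∈ e → w' e = 0 ∨ w' e = 1 := fun e he => h2 e (by rwa [hmemP])
    have := hcorner w' h1' h2'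
    show (prodBernoulli w').real S₁ - (prodBernoulli w').real S₂ -
      c * ((prodBernoulli w').real S₃ - (prodBernoulli w').real S₄) ≤ 0
    linarith
  have hΦw : (prodBernoulli w).real S₁ - (prodBernoulli w).real S₂ -
      c * ((prodBernoulli w).real S₃ - (prodBernoulli w).real S₄) ≤ 0 := key
  have hB : c * ((prodBernoulli w).real S₃ - (prodBernoulli w).real S₄) ≤ 0 :=
    mul_nonpos_of_nonneg_of_nonpos hc (by linarith)
  linarith

/-! ### GREX ⇒ REX ⇒ the crux -/

/-- **REX from GREX.**  Suppose the glued restricted-attachment exchange holds: for every weight function whose pairs at the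
observer `o ∉ A` are all `0` or `1`, writing `w⁰ = w[pairs at o ↦ 0]` and `β_x = μ_{w⁰}(L_x) − μ_{w⁰}(L_q)`,
(GREX-0) `β_x ≤ 0` for all `x ∈ Q` implies `F(w) ≤ 0`, and (GREX-1) `x⋆ ∈ Q` with `β_{x⋆} > 0` maximal implies
`F(w) ≤ B_{x⋆}(w)`.  Then REX holds for every observer: if `q` beats `Q` in `w` then `F(w) ≤ 0`. [this work] -/
theorem rex_of_grex
    (hGREX : ∀ (n : ℕ) (w : Sym2 (Fin n) → unitInterval) (A Q : Finset (Fin n)) (o q : Fin n) (j : ℕ),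
      o ∉ A → q ∈ A → Q ⊆ A.erase q → (∀ e : Sym2 (Fin n), o ∈ e → w e = 0 ∨ w e = 1) →
      ((∀ x ∈ Q,
          (prodBernoulli (fun e => if o ∈ e then (0 : unitInterval) else w e)).real
              {ω : BondConfig (Fin n) | (A.filter fun a => ω ∈ openConn x a).card ≤ j} ≤
            (prodBernoulli (fun e => if o ∈ e then (0 : unitInterval) else w e)).real
              {ω : BondConfig (Fin n) | (A.filter fun a => ω ∈ openConn q a).card ≤ j}) →
        (prodBernoulli w).real ((⋃ y ∈ Q, (openConn o y : Set (BondConfig (Fin n)))) ∩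
            {ω | (A.filter fun a => ω ∈ openConn o a).card ≤ j} ∩ {ω | j < (A.filter fun a => ω ∈ openConn q a).card}) ≤
          (prodBernoulli w).real ((⋃ y ∈ Q, (openConn o y : Set (BondConfig (Fin n)))) ∩
            {ω | j < (A.filter fun a => ω ∈ openConn o a).card} ∩ {ω | (A.filter fun a => ω ∈ openConn q a).card ≤ j})) ∧
      (∀ xs ∈ Q,
        (prodBernoulli (fun e => if o ∈ e then (0 : unitInterval) else w e)).real
            {ω : BondConfig (Fin n) | (A.filter fun a => ω ∈ openConn q a).card ≤ j} <
          (prodBernoulli (fun e => if o ∈ e then (0 : unitInterval) else w e)).real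
            {ω : BondConfig (Fin n) | (A.filter fun a => ω ∈ openConn xs a).card ≤ j} →
        (∀ x ∈ Q,
          (prodBernoulli (fun e => if o ∈ e then (0 : unitInterval) else w e)).real
              {ω : BondConfig (Fin n) | (A.filter fun a => ω ∈ openConn x a).card ≤ j} ≤
            (prodBernoulli (fun e => if o ∈ e then (0 : unitInterval) else w e)).real
              {ω : BondConfig (Fin n) | (A.filter fun a => ω ∈ openConn xs a).card ≤ j}) →
        (prodBernoulli w).real ((⋃ y ∈ Q, (openConn o y : Set (BondConfig (Fin n)))) ∩
            {ω | (A.filter fun a => ω ∈ openConn o a).card ≤ j} ∩ {ω | j < (A.filter fun a => ω ∈ openConn q a).card}) -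
          (prodBernoulli w).real ((⋃ y ∈ Q, (openConn o y : Set (BondConfig (Fin n)))) ∩
            {ω | j < (A.filter fun a => ω ∈ openConn o a).card} ∩ {ω | (A.filter fun a => ω ∈ openConn q a).card ≤ j}) ≤
        (prodBernoulli w).real {ω : BondConfig (Fin n) | (A.filter fun a => ω ∈ openConn xs a).card ≤ j} -
          (prodBernoulli w).real {ω : BondConfig (Fin n) | (A.filter fun a => ω ∈ openConn q a).card ≤ j}))
    (n : ℕ) (w : Sym2 (Fin n) → unitInterval) (A Q : Finset (Fin n)) (o q : Fin n) (j : ℕ)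
    (ho : o ∉ A) (hq : q ∈ A) (hQ : Q ⊆ A.erase q)
    (hbeat : ∀ x ∈ Q, (prodBernoulli w).real {ω : BondConfig (Fin n) | (A.filter fun a => ω ∈ openConn x a).card ≤ j} ≤
      (prodBernoulli w).real {ω : BondConfig (Fin n) | (A.filter fun a => ω ∈ openConn q a).card ≤ j}) :
    (prodBernoulli w).real ((⋃ y ∈ Q, (openConn o y : Set (BondConfig (Fin n)))) ∩
          {ω | (A.filter fun a => ω ∈ openConn o a).card ≤ j} ∩ {ω | j < (A.filter fun a => ω ∈ openConn q a).card}) ≤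
      (prodBernoulli w).real ((⋃ y ∈ Q, (openConn o y : Set (BondConfig (Fin n)))) ∩
          {ω | j < (A.filter fun a => ω ∈ openConn o a).card} ∩ {ω | (A.filter fun a => ω ∈ openConn q a).card ≤ j}) := by
  -- the common observer-free weights of all corners
  set w0 : Sym2 (Fin n) → unitInterval := fun e => if o ∈ e then (0 : unitInterval) else w e with hw0
  set Sx : Fin n → Set (BondConfig (Fin n)) := fun x => {ω | (A.filter fun a => ω ∈ openConn x a).card ≤ j} with hSx
  -- corners have the same `w0`
  have hcornerw0 : ∀ w' : Sym2 (Fin n) → unitInterval, (∀ e : Sym2 (Fin n), o ∉ e → w' e = w e) →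
      (fun e => if o ∈ e then (0 : unitInterval) else w' e) = w0 := by
    intro w' h1
    funext e
    by_cases he : o ∈ e
    · simp only [hw0, he, if_true]
    · simp only [hw0, he, if_false, h1 e he]
  by_cases hcase : ∀ x ∈ Q, (prodBernoulli w0).real (Sx x) ≤ (prodBernoulli w0).real (Sx q)
  · -- GREX-0 at every corner, with `c = 0` (take `x := q`, the bound `c · B_q = 0`)
    refine rex_of_corners_dominated w A Q o q q j 0 le_rfl ?_ le_rfl
    intro w' h1 h2
    have hG := (hGREX n w' A Q o q j ho hq hQ h2).1
    rw [hcornerw0 w' h1] at hG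
    have := hG hcase
    linarith
  · -- GREX-1: pick a maximiser `xs` of `β` over `Q`; it has `β_{xs} > 0`
    push Not at hcase
    obtain ⟨x₁, hx₁Q, hx₁⟩ := hcase
    have hQne : Q.Nonempty := ⟨x₁, hx₁Q⟩
    obtain ⟨xs, hxsQ, hxsmax⟩ := Finset.exists_max_image Q (fun x => (prodBernoulli w0).real (Sx x)) hQne
    have hxs_pos : (prodBernoulli w0).real (Sx q) < (prodBernoulli w0).real (Sx xs) := lt_of_lt_of_le hx₁ (hxsmax x₁ hx₁Q)
    refine rex_of_corners_dominated w A Q o q xs j 1 zero_le_one ?_ (hbeat xs hxsQ)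
    intro w' h1 h2
    have hG := (hGREX n w' A Q o q j ho hq hQ h2).2 xs hxsQ
    rw [hcornerw0 w' h1] at hG
    have := hG hxs_pos (fun x hx => hxsmax x hx)
    linarith

/-- **GREX closes the crux.**  The glued restricted-attachment exchange (GREX-0 and GREX-1, for deterministically glued
observers, with beating measured in the observer-free weights `w⁰`) implies `NoHeavyLowerTail`, through `rex_of_grex` and
`RestrictedAttachmentExchange.noHeavyLowerTail_of_rex`. [this work] -/
theorem noHeavyLowerTail_of_grex
    (hGREX : ∀ (n : ℕ) (w : Sym2 (Fin n) → unitInterval) (A Q : Finset (Fin n)) (o q : Fin n) (j : ℕ),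
      o ∉ A → q ∈ A → Q ⊆ A.erase q → (∀ e : Sym2 (Fin n), o ∈ e → w e = 0 ∨ w e = 1) →
      ((∀ x ∈ Q,
          (prodBernoulli (fun e => if o ∈ e then (0 : unitInterval) else w e)).real
              {ω : BondConfig (Fin n) | (A.filter fun a => ω ∈ openConn x a).card ≤ j} ≤
            (prodBernoulli (fun e => if o ∈ e then (0 : unitInterval) else w e)).real
              {ω : BondConfig (Fin n) | (A.filter fun a => ω ∈ openConn q a).card ≤ j}) →
        (prodBernoulli w).real ((⋃ y ∈ Q, (openConn o y : Set (BondConfig (Fin n)))) ∩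
            {ω | (A.filter fun a => ω ∈ openConn o a).card ≤ j} ∩ {ω | j < (A.filter fun a => ω ∈ openConn q a).card}) ≤
          (prodBernoulli w).real ((⋃ y ∈ Q, (openConn o y : Set (BondConfig (Fin n)))) ∩
            {ω | j < (A.filter fun a => ω ∈ openConn o a).card} ∩ {ω | (A.filter fun a => ω ∈ openConn q a).card ≤ j})) ∧
      (∀ xs ∈ Q,
        (prodBernoulli (fun e => if o ∈ e then (0 : unitInterval) else w e)).real
            {ω : BondConfig (Fin n) | (A.filter fun a => ω ∈ openConn q a).card ≤ j} <
          (prodBernoulli (fun e => if o ∈ e then (0 : unitInterval) else w e)).real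
            {ω : BondConfig (Fin n) | (A.filter fun a => ω ∈ openConn xs a).card ≤ j} →
        (∀ x ∈ Q,
          (prodBernoulli (fun e => if o ∈ e then (0 : unitInterval) else w e)).real
              {ω : BondConfig (Fin n) | (A.filter fun a => ω ∈ openConn x a).card ≤ j} ≤
            (prodBernoulli (fun e => if o ∈ e then (0 : unitInterval) else w e)).real
              {ω : BondConfig (Fin n) | (A.filter fun a => ω ∈ openConn xs a).card ≤ j}) →
        (prodBernoulli w).real ((⋃ y ∈ Q, (openConn o y : Set (BondConfig (Fin n)))) ∩
            {ω | (A.filter fun a => ω ∈ openConn o a).card ≤ j} ∩ {ω | j < (A.filter fun a => ω ∈ openConn q a).card}) -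
          (prodBernoulli w).real ((⋃ y ∈ Q, (openConn o y : Set (BondConfig (Fin n)))) ∩
            {ω | j < (A.filter fun a => ω ∈ openConn o a).card} ∩ {ω | (A.filter fun a => ω ∈ openConn q a).card ≤ j}) ≤
        (prodBernoulli w).real {ω : BondConfig (Fin n) | (A.filter fun a => ω ∈ openConn xs a).card ≤ j} -
          (prodBernoulli w).real {ω : BondConfig (Fin n) | (A.filter fun a => ω ∈ openConn q a).card ≤ j})) :
    Summit.CriticalPhenomena.PercolationContinuityZ3.Theses.PercNearOneGluing.NoHeavyLowerTail := by
  refine RestrictedAttachmentExchange.noHeavyLowerTail_of_rex ?_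
  intro n w A Q o q j ho hq hQ hbeat
  have key := rex_of_grex hGREX n w A Q o q j ho hq hQ hbeat
  refine le_trans (measureReal_mono ?_ (measure_ne_top _ _)) key
  rintro ω ⟨⟨hU, -, hl⟩, hh⟩
  exact ⟨⟨hU, hl⟩, hh⟩

/-! ### Appendix (gen 11, second landing): the hypothesis-free form (AREX) -/

/-- **AREX from GREX (hypothesis-free corner bound).**  Under the GREX hypothesis of `rex_of_grex`, for EVERY observer `o ∉ A` and
every weight function `w` (no beating assumed): if `q` beats `Q` in the observer-free weights `w⁰ = w[pairs at o ↦ 0]` then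
`F(w) ≤ 0`; and if `x⋆ ∈ Q` maximises `β = B(w⁰)` with `β_{x⋆} > 0` then `F(w) ≤ B_{x⋆}(w)` — the anchor is the graph WITHOUT the
observer, the conclusion is in the graph with it. [this work] -/
theorem arex_of_grex
    (hGREX : ∀ (n : ℕ) (w : Sym2 (Fin n) → unitInterval) (A Q : Finset (Fin n)) (o q : Fin n) (j : ℕ),
      o ∉ A → q ∈ A → Q ⊆ A.erase q → (∀ e : Sym2 (Fin n), o ∈ e → w e = 0 ∨ w e = 1) →
      ((∀ x ∈ Q,
          (prodBernoulli (fun e => if o ∈ e then (0 : unitInterval) else w e)).real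
              {ω : BondConfig (Fin n) | (A.filter fun a => ω ∈ openConn x a).card ≤ j} ≤
            (prodBernoulli (fun e => if o ∈ e then (0 : unitInterval) else w e)).real
              {ω : BondConfig (Fin n) | (A.filter fun a => ω ∈ openConn q a).card ≤ j}) →
        (prodBernoulli w).real ((⋃ y ∈ Q, (openConn o y : Set (BondConfig (Fin n)))) ∩
            {ω | (A.filter fun a => ω ∈ openConn o a).card ≤ j} ∩ {ω | j < (A.filter fun a => ω ∈ openConn q a).card}) ≤
          (prodBernoulli w).real ((⋃ y ∈ Q, (openConn o y : Set (BondConfig (Fin n)))) ∩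
            {ω | j < (A.filter fun a => ω ∈ openConn o a).card} ∩ {ω | (A.filter fun a => ω ∈ openConn q a).card ≤ j})) ∧
      (∀ xs ∈ Q,
        (prodBernoulli (fun e => if o ∈ e then (0 : unitInterval) else w e)).real
            {ω : BondConfig (Fin n) | (A.filter fun a => ω ∈ openConn q a).card ≤ j} <
          (prodBernoulli (fun e => if o ∈ e then (0 : unitInterval) else w e)).real
            {ω : BondConfig (Fin n) | (A.filter fun a => ω ∈ openConn xs a).card ≤ j} →
        (∀ x ∈ Q,
          (prodBernoulli (fun e => if o ∈ e then (0 : unitInterval) else w e)).real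
              {ω : BondConfig (Fin n) | (A.filter fun a => ω ∈ openConn x a).card ≤ j} ≤
            (prodBernoulli (fun e => if o ∈ e then (0 : unitInterval) else w e)).real
              {ω : BondConfig (Fin n) | (A.filter fun a => ω ∈ openConn xs a).card ≤ j}) →
        (prodBernoulli w).real ((⋃ y ∈ Q, (openConn o y : Set (BondConfig (Fin n)))) ∩
            {ω | (A.filter fun a => ω ∈ openConn o a).card ≤ j} ∩ {ω | j < (A.filter fun a => ω ∈ openConn q a).card}) -
          (prodBernoulli w).real ((⋃ y ∈ Q, (openConn o y : Set (BondConfig (Fin n)))) ∩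
            {ω | j < (A.filter fun a => ω ∈ openConn o a).card} ∩ {ω | (A.filter fun a => ω ∈ openConn q a).card ≤ j}) ≤
        (prodBernoulli w).real {ω : BondConfig (Fin n) | (A.filter fun a => ω ∈ openConn xs a).card ≤ j} -
          (prodBernoulli w).real {ω : BondConfig (Fin n) | (A.filter fun a => ω ∈ openConn q a).card ≤ j}))
    (n : ℕ) (w : Sym2 (Fin n) → unitInterval) (A Q : Finset (Fin n)) (o q : Fin n) (j : ℕ)
    (ho : o ∉ A) (hq : q ∈ A) (hQ : Q ⊆ A.erase q) :
    ((∀ x ∈ Q,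
        (prodBernoulli (fun e => if o ∈ e then (0 : unitInterval) else w e)).real
            {ω : BondConfig (Fin n) | (A.filter fun a => ω ∈ openConn x a).card ≤ j} ≤
          (prodBernoulli (fun e => if o ∈ e then (0 : unitInterval) else w e)).real
            {ω : BondConfig (Fin n) | (A.filter fun a => ω ∈ openConn q a).card ≤ j}) →
      (prodBernoulli w).real ((⋃ y ∈ Q, (openConn o y : Set (BondConfig (Fin n)))) ∩
          {ω | (A.filter fun a => ω ∈ openConn o a).card ≤ j} ∩ {ω | j < (A.filter fun a => ω ∈ openConn q a).card}) ≤
        (prodBernoulli w).real ((⋃ y ∈ Q, (openConn o y : Set (BondConfig (Fin n)))) ∩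
          {ω | j < (A.filter fun a => ω ∈ openConn o a).card} ∩ {ω | (A.filter fun a => ω ∈ openConn q a).card ≤ j})) ∧
    (∀ xs ∈ Q,
      (prodBernoulli (fun e => if o ∈ e then (0 : unitInterval) else w e)).real
          {ω : BondConfig (Fin n) | (A.filter fun a => ω ∈ openConn q a).card ≤ j} <
        (prodBernoulli (fun e => if o ∈ e then (0 : unitInterval) else w e)).real
          {ω : BondConfig (Fin n) | (A.filter fun a => ω ∈ openConn xs a).card ≤ j} →
      (∀ x ∈ Q,
        (prodBernoulli (fun e => if o ∈ e then (0 : unitInterval) else w e)).real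
            {ω : BondConfig (Fin n) | (A.filter fun a => ω ∈ openConn x a).card ≤ j} ≤
          (prodBernoulli (fun e => if o ∈ e then (0 : unitInterval) else w e)).real
            {ω : BondConfig (Fin n) | (A.filter fun a => ω ∈ openConn xs a).card ≤ j}) →
      (prodBernoulli w).real ((⋃ y ∈ Q, (openConn o y : Set (BondConfig (Fin n)))) ∩
          {ω | (A.filter fun a => ω ∈ openConn o a).card ≤ j} ∩ {ω | j < (A.filter fun a => ω ∈ openConn q a).card}) -
        (prodBernoulli w).real ((⋃ y ∈ Q, (openConn o y : Set (BondConfig (Fin n)))) ∩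
          {ω | j < (A.filter fun a => ω ∈ openConn o a).card} ∩ {ω | (A.filter fun a => ω ∈ openConn q a).card ≤ j}) ≤
      (prodBernoulli w).real {ω : BondConfig (Fin n) | (A.filter fun a => ω ∈ openConn xs a).card ≤ j} -
        (prodBernoulli w).real {ω : BondConfig (Fin n) | (A.filter fun a => ω ∈ openConn q a).card ≤ j}) := by
  set w0 : Sym2 (Fin n) → unitInterval := fun e => if o ∈ e then (0 : unitInterval) else w e with hw0
  set S₁ : Set (BondConfig (Fin n)) := (⋃ y ∈ Q, (openConn o y : Set (BondConfig (Fin n)))) ∩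
    {ω | (A.filter fun a => ω ∈ openConn o a).card ≤ j} ∩ {ω | j < (A.filter fun a => ω ∈ openConn q a).card} with hS₁
  set S₂ : Set (BondConfig (Fin n)) := (⋃ y ∈ Q, (openConn o y : Set (BondConfig (Fin n)))) ∩
    {ω | j < (A.filter fun a => ω ∈ openConn o a).card} ∩ {ω | (A.filter fun a => ω ∈ openConn q a).card ≤ j} with hS₂
  set Sx : Fin n → Set (BondConfig (Fin n)) := fun x => {ω | (A.filter fun a => ω ∈ openConn x a).card ≤ j} with hSx
  have hcornerw0 : ∀ w' : Sym2 (Fin n) → unitInterval, (∀ e : Sym2 (Fin n), o ∉ e → w' e = w e) →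
      (fun e => if o ∈ e then (0 : unitInterval) else w' e) = w0 := by
    intro w' h1
    funext e
    by_cases he : o ∈ e
    · simp only [hw0, he, if_true]
    · simp only [hw0, he, if_false, h1 e he]
  set P : Finset (Sym2 (Fin n)) := Finset.univ.filter fun e => o ∈ e with hP
  have hmemP : ∀ e : Sym2 (Fin n), e ∈ P ↔ o ∈ e := by
    intro e; simp only [hP, Finset.mem_filter, Finset.mem_univ, true_and]
  -- the corner lemma for `Φ = F − c·(B_x)` with the hypothesis read off GREX at the corners
  have main : ∀ (x : Fin n) (c : ℝ),
      (∀ w' : Sym2 (Fin n) → unitInterval, (∀ e : Sym2 (Fin n), o ∉ e → w' e = w e) →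
        (∀ e : Sym2 (Fin n), o ∈ e → w' e = 0 ∨ w' e = 1) →
        (prodBernoulli w').real S₁ - (prodBernoulli w').real S₂ ≤
          c * ((prodBernoulli w').real (Sx x) - (prodBernoulli w').real (Sx q))) →
      (prodBernoulli w).real S₁ - (prodBernoulli w).real S₂ ≤
        c * ((prodBernoulli w).real (Sx x) - (prodBernoulli w).real (Sx q)) := by
    intro x c hc
    have key : (prodBernoulli w).real S₁ - (prodBernoulli w).real S₂ -
        c * ((prodBernoulli w).real (Sx x) - (prodBernoulli w).real (Sx q)) ≤ 0 := by
      refine cornerLemma P (fun u => (prodBernoulli u).real S₁ - (prodBernoulli u).real S₂ -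
        c * ((prodBernoulli u).real (Sx x) - (prodBernoulli u).real (Sx q)))
        (fun u e _ => affine_combo S₁ S₂ (Sx x) (Sx q) c u e) w ?_
      intro w' h1 h2
      have := hc w' (fun e he => h1 e (by rwa [hmemP])) (fun e he => h2 e (by rwa [hmemP]))
      linarith
    linarith
  refine ⟨fun hcase => ?_, fun xs hxsQ hpos hmax => ?_⟩
  · have h := main q 0 (fun w' h1 h2 => by
      have hG := (hGREX n w' A Q o q j ho hq hQ h2).1
      rw [hcornerw0 w' h1] at hG
      have := hG hcase
      linarith)
    linarith
  · have h := main xs 1 (fun w' h1 h2 => by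
      have hG := (hGREX n w' A Q o q j ho hq hQ h2).2 xs hxsQ
      rw [hcornerw0 w' h1] at hG
      have := hG hpos hmax
      linarith)
    linarith

end CornerReduction

end Summit.CriticalPhenomena.PercolationContinuityZ3.Theorems

end
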